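import Summits.ValiantsHypothesis.ValiantsHypothesis.Theorems.LacunarySymmetroidMatrixDescartesCensusDoorA34HollowCornerSigned

/-!
# `MatrixDescartes` census — DOOR A at `(3,4)`: the NODE FORM of the door — `DoorA34` ⟺ three explicit fewnomial row families,
# Cayley's `e₃` on four node `4`-nomials with `0 / 1 / 2` complex-conjugate pairs (no matrix, no gauge, no side condition)

HONEST FRAMING.  Object-search cell `pub-symmetroid`, door-A seat `val-sym-door-p3` (g18); item stmt-ValiantsHypothesis-19980
`DoorA34 = PosRootLawAt 3 4 18` is OPEN and asserted nowhere in this file.  The theorems are EQUIVALENCES between the door (and each support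
row `PosRootLawOn 3 4 18 d`) and three explicit families of fewnomial rows; NONE of the families is bounded here.  Nothing bounds
`ζ_sym(3,4)`; nothing bears on `MatrixDescartes` (stmt-ValiantsHypothesis-18050) or on `VP ≠ VNP`.

CONTENT (all supports; no `def`, no `sorry`).  Write `N(c) = ∑_l C(c_l)·X^{d_l}` for the `4`-nomial with coefficient vector `c` on the
support `d` (a «node form»).  `…HollowCornerSigned` proved `PosRootLawOn 3 4 18 d ↔` the SIGNED hollow-corner rows on `d`.  Here the three
sign classes are rewritten as polynomial identities in node coordinates:
* `pencil_hollowCorner_eq`, `det_pencil_hollowCorner` — the hollow-corner pencil IS the matrix `[[C ε₁·U + C ε₂·W, A, B],[A,U,0],[B,0,W]]`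
  of node forms, `det = UW(ε₁U+ε₂W) − A²W − B²U`;
* `two_mul_det_pencil_R4`: `2·det(1,1) = e₃(N(u−α), N(u+α), N(w−β), N(w+β))` (four REAL nodes);
  `neg_two_mul_det_pencil_R2` / `…R2'`: `−2·det(1,−1) = (P²+Q²)(L₀+L₁) + 2·P·L₀L₁` with `P = N(−w), Q = N(β), L = N(u∓α)` (two real
  nodes, one conjugate pair `P ± iQ`), and the mirror class `(−1,1)`; `neg_det_pencil_R0`: `−det(−1,−1) = R(P²+Q²) + P(R²+S²)` with
  `(P,Q,R,S) = (N u, N α, N w, N β)` (two conjugate pairs `P ± iQ`, `R ± iS`: `e₃ = 2·(R|P+iQ|² + P|R+iS|²)`);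
* **`posRootLawOn_iff_nodeRows`** (every `d`) and **`doorA34_iff_nodeRows`**:
  `DoorA34 ↔ (R4) ∧ (R2) ∧ (R0)` where, for all supports `d` and all real coefficient data,
  (R4) `Z₊(∑ᵢ ∏_{j≠i} N(ℓⱼ)) ≤ 18` — `e₃` of FOUR ARBITRARY REAL `4`-NOMIALS `N(ℓ₀),…,N(ℓ₃)` on `d`;
  (R2) `Z₊((P²+Q²)(L₀+L₁) + 2·P·L₀·L₁) ≤ 18`;  (R0) `Z₊(R(P²+Q²) + P(R²+S²)) ≤ 18`;
  and the refutation currency `not_doorA34_iff_nodeNineteen`.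
READING.  `det(∑ x^{d_l}S_l) = c·e₃(ℓ₁(x),…,ℓ₄(x))` is Cayley's four-nodal cubic `1/y₁+1/y₂+1/y₃+1/y₄ = 0` composed with the node
forms; the door says that this ONE cubic surface (in its three real forms) meets the positive arc of every projectively transformed
monomial curve `x ↦ (x^{d_l})` in at most `18` points, one below the Descartes ceiling `19` that general cubic surfaces attain
(`Census.G3K4E1`).  [folklore] Cayley symmetroid / Sylvester pentahedron; elementary.
-/

-- `Summit.ValiantsHypothesis.ValiantsHypothesis.…` repeats a component by the D-0017 layout
-- (single-conjunct summit), which the `dupNamespace` linter flags; the name is mandated.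
set_option linter.dupNamespace false

namespace Summit.ValiantsHypothesis.ValiantsHypothesis.Theorems.LacunarySymmetroidMatrixDescartes.Census.EqualDiagonal

open Matrix Finset Polynomial
open scoped BigOperators
open Summit.ValiantsHypothesis.ValiantsHypothesis.Theorems.MatrixDescartes.Negative (PosRootLawAt)

/-! ## 21. The hollow-corner pencil in node coordinates -/

/-- **The hollow-corner pencil as an explicit matrix of fewnomials**: with the node forms `U = ∑ C(u_l)X^{d_l}`, `W`, `A`, `B`, the pencil
`∑_l X^{d_l}[[ε₁u_l+ε₂w_l, α_l, β_l],[α_l,u_l,0],[β_l,0,w_l]]` is `[[C ε₁·U + C ε₂·W, A, B],[A, U, 0],[B, 0, W]]`. [folklore] -/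
theorem pencil_hollowCorner_eq (d : Fin 4 → ℕ) (ε₁ ε₂ : ℝ) (u w α β : Fin 4 → ℝ) :
    (∑ l, ((X : ℝ[X]) ^ d l) • (!![ε₁ * u l + ε₂ * w l, α l, β l; α l, u l, 0; β l, 0, w l] : Matrix (Fin 3) (Fin 3) ℝ).map C)
      = !![C ε₁ * (∑ l, C (u l) * X ^ d l) + C ε₂ * (∑ l, C (w l) * X ^ d l), ∑ l, C (α l) * X ^ d l, ∑ l, C (β l) * X ^ d l;
           ∑ l, C (α l) * X ^ d l, ∑ l, C (u l) * X ^ d l, 0;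
           ∑ l, C (β l) * X ^ d l, 0, ∑ l, C (w l) * X ^ d l] := by
  have hcomm : ∀ f : Fin 4 → ℝ, (∑ l, (X : ℝ[X]) ^ d l * C (f l)) = ∑ l, C (f l) * X ^ d l :=
    fun f => Finset.sum_congr rfl fun l _ => mul_comm _ _
  have hzero : (∑ l, (X : ℝ[X]) ^ d l * C ((0 : ℝ))) = 0 := by simp
  have hcorner : (∑ l, (X : ℝ[X]) ^ d l * C (ε₁ * u l + ε₂ * w l))
      = C ε₁ * (∑ l, C (u l) * X ^ d l) + C ε₂ * (∑ l, C (w l) * X ^ d l) := by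
    rw [Finset.mul_sum, Finset.mul_sum, ← Finset.sum_add_distrib]
    exact Finset.sum_congr rfl fun l _ => by rw [map_add, map_mul, map_mul]; ring
  refine Matrix.ext fun i j => ?_
  rw [Matrix.sum_apply]
  simp only [Matrix.smul_apply, Matrix.map_apply, smul_eq_mul]
  fin_cases i <;> fin_cases j <;>
    simp only [Matrix.cons_val', Matrix.cons_val_zero, Matrix.cons_val_one, Matrix.cons_val_two, Matrix.empty_val',
      Matrix.cons_val_fin_one, Matrix.head_cons, Matrix.tail_cons, Matrix.head_fin_const, Matrix.of_apply,
      Fin.zero_eta, Fin.isValue, Fin.mk_one, Fin.reduceFinMk] <;>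
    first | exact hcorner | exact hcomm _ | exact hzero

/-- **Determinant of the hollow-corner pencil in node coordinates**: `UW(C ε₁·U + C ε₂·W) − A²W − B²U`. [folklore] -/
theorem det_pencil_hollowCorner (d : Fin 4 → ℕ) (ε₁ ε₂ : ℝ) (u w α β : Fin 4 → ℝ) :
    (∑ l, ((X : ℝ[X]) ^ d l) • (!![ε₁ * u l + ε₂ * w l, α l, β l; α l, u l, 0; β l, 0, w l] : Matrix (Fin 3) (Fin 3) ℝ).map C).det
      = (∑ l, C (u l) * X ^ d l) * (∑ l, C (w l) * X ^ d l) * (C ε₁ * (∑ l, C (u l) * X ^ d l) + C ε₂ * (∑ l, C (w l) * X ^ d l))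
        - (∑ l, C (α l) * X ^ d l) ^ 2 * (∑ l, C (w l) * X ^ d l) - (∑ l, C (β l) * X ^ d l) ^ 2 * (∑ l, C (u l) * X ^ d l) := by
  rw [pencil_hollowCorner_eq, det_hollowCorner]

/-- Node forms are additive in the coefficient vector. [folklore] -/
theorem nodeForm_add (d : Fin 4 → ℕ) (a b : Fin 4 → ℝ) :
    (∑ l, C (a l + b l) * (X : ℝ[X]) ^ d l) = (∑ l, C (a l) * X ^ d l) + ∑ l, C (b l) * X ^ d l := by
  rw [← Finset.sum_add_distrib]
  exact Finset.sum_congr rfl fun l _ => by rw [map_add, add_mul]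

/-- Node forms are subtractive in the coefficient vector. [folklore] -/
theorem nodeForm_sub (d : Fin 4 → ℕ) (a b : Fin 4 → ℝ) :
    (∑ l, C (a l - b l) * (X : ℝ[X]) ^ d l) = (∑ l, C (a l) * X ^ d l) - ∑ l, C (b l) * X ^ d l := by
  rw [← Finset.sum_sub_distrib]
  exact Finset.sum_congr rfl fun l _ => by rw [map_sub, sub_mul]

/-- The node form of `−c` is `−N(c)`. [folklore] -/
theorem nodeForm_neg (d : Fin 4 → ℕ) (a : Fin 4 → ℝ) :
    (∑ l, C (-a l) * (X : ℝ[X]) ^ d l) = -∑ l, C (a l) * X ^ d l := by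
  rw [← Finset.sum_neg_distrib]
  exact Finset.sum_congr rfl fun l _ => by rw [map_neg, neg_mul]

/-- `e₃` as «the sum over the four nodes of the product of the other three node forms». [folklore] -/
theorem e3_eq_sum_prod_erase (L : Fin 4 → ℝ[X]) :
    ∑ i, ∏ j ∈ Finset.univ.erase i, L j = L 0 * L 1 * L 2 + L 0 * L 1 * L 3 + L 0 * L 2 * L 3 + L 1 * L 2 * L 3 := by
  have h0 : (Finset.univ : Finset (Fin 4)).erase 0 = {1, 2, 3} := by decide
  have h1 : (Finset.univ : Finset (Fin 4)).erase 1 = {0, 2, 3} := by decide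
  have h2 : (Finset.univ : Finset (Fin 4)).erase 2 = {0, 1, 3} := by decide
  have h3 : (Finset.univ : Finset (Fin 4)).erase 3 = {0, 1, 2} := by decide
  rw [Fin.sum_univ_four, h0, h1, h2, h3]
  simp [Finset.prod_insert, Finset.prod_singleton]
  ring

/-! ## 22. The three sign classes as node polynomials -/

/-- **Class R4 (`ε = (1,1)`, four real nodes)**: `2·det = e₃(N(u−α), N(u+α), N(w−β), N(w+β))`, written as the sum over the four
nodes of the product of the other three node forms. [folklore] -/
theorem two_mul_det_pencil_R4 (d : Fin 4 → ℕ) (u w α β : Fin 4 → ℝ) :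
    2 * (∑ l, ((X : ℝ[X]) ^ d l) • (!![1 * u l + 1 * w l, α l, β l; α l, u l, 0; β l, 0, w l] : Matrix (Fin 3) (Fin 3) ℝ).map C).det
      = ∑ i, ∏ j ∈ Finset.univ.erase i, ∑ l, C ((![u - α, u + α, w - β, w + β] : Fin 4 → Fin 4 → ℝ) j l) * X ^ d l := by
  rw [det_pencil_hollowCorner, e3_eq_sum_prod_erase]
  simp only [Matrix.cons_val_zero, Matrix.cons_val_one, Matrix.cons_val_two, Matrix.cons_val_three, Matrix.head_cons,
    Matrix.tail_cons, Pi.add_apply, Pi.sub_apply, nodeForm_add, nodeForm_sub, map_one]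
  ring

/-- **Class R2 (`ε = (1,−1)`: real nodes `N(u∓α)`, conjugate pair `N(−w) ± i·N(β)`)**:
`−2·det = (P² + Q²)(L₀ + L₁) + 2·P·L₀·L₁` with `P = N(−w)`, `Q = N(β)`, `L₀ = N(u−α)`, `L₁ = N(u+α)`. [folklore] -/
theorem neg_two_mul_det_pencil_R2 (d : Fin 4 → ℕ) (u w α β : Fin 4 → ℝ) :
    -2 * (∑ l, ((X : ℝ[X]) ^ d l) • (!![1 * u l + (-1) * w l, α l, β l; α l, u l, 0; β l, 0, w l] : Matrix (Fin 3) (Fin 3) ℝ).map C).det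
      = ((∑ l, C ((-w) l) * X ^ d l) ^ 2 + (∑ l, C (β l) * X ^ d l) ^ 2)
            * ((∑ l, C ((![u - α, u + α] : Fin 2 → Fin 4 → ℝ) 0 l) * X ^ d l)
              + (∑ l, C ((![u - α, u + α] : Fin 2 → Fin 4 → ℝ) 1 l) * X ^ d l))
          + 2 * (∑ l, C ((-w) l) * X ^ d l) * (∑ l, C ((![u - α, u + α] : Fin 2 → Fin 4 → ℝ) 0 l) * X ^ d l)
              * (∑ l, C ((![u - α, u + α] : Fin 2 → Fin 4 → ℝ) 1 l) * X ^ d l) := by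
  have hn : (∑ l, C ((-w) l) * (X : ℝ[X]) ^ d l) = -∑ l, C (w l) * X ^ d l := nodeForm_neg d w
  have h0 : (∑ l, C ((![u - α, u + α] : Fin 2 → Fin 4 → ℝ) 0 l) * (X : ℝ[X]) ^ d l)
      = (∑ l, C (u l) * X ^ d l) - ∑ l, C (α l) * X ^ d l := nodeForm_sub d u α
  have h1 : (∑ l, C ((![u - α, u + α] : Fin 2 → Fin 4 → ℝ) 1 l) * (X : ℝ[X]) ^ d l)
      = (∑ l, C (u l) * X ^ d l) + ∑ l, C (α l) * X ^ d l := nodeForm_add d u α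
  rw [det_pencil_hollowCorner, hn, h0, h1, map_one, map_neg, map_one]
  ring

/-- **Class R2, mirror sign pattern (`ε = (−1,1)`: real nodes `N(w∓β)`, conjugate pair `N(−u) ± i·N(α)`)**:
`−2·det = (P² + Q²)(L₀ + L₁) + 2·P·L₀·L₁` with `P = N(−u)`, `Q = N(α)`, `L₀ = N(w−β)`, `L₁ = N(w+β)`. [folklore] -/
theorem neg_two_mul_det_pencil_R2' (d : Fin 4 → ℕ) (u w α β : Fin 4 → ℝ) :
    -2 * (∑ l, ((X : ℝ[X]) ^ d l) • (!![(-1) * u l + 1 * w l, α l, β l; α l, u l, 0; β l, 0, w l] : Matrix (Fin 3) (Fin 3) ℝ).map C).det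
      = ((∑ l, C ((-u) l) * X ^ d l) ^ 2 + (∑ l, C (α l) * X ^ d l) ^ 2)
            * ((∑ l, C ((![w - β, w + β] : Fin 2 → Fin 4 → ℝ) 0 l) * X ^ d l)
              + (∑ l, C ((![w - β, w + β] : Fin 2 → Fin 4 → ℝ) 1 l) * X ^ d l))
          + 2 * (∑ l, C ((-u) l) * X ^ d l) * (∑ l, C ((![w - β, w + β] : Fin 2 → Fin 4 → ℝ) 0 l) * X ^ d l)
              * (∑ l, C ((![w - β, w + β] : Fin 2 → Fin 4 → ℝ) 1 l) * X ^ d l) := by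
  have hn : (∑ l, C ((-u) l) * (X : ℝ[X]) ^ d l) = -∑ l, C (u l) * X ^ d l := nodeForm_neg d u
  have h0 : (∑ l, C ((![w - β, w + β] : Fin 2 → Fin 4 → ℝ) 0 l) * (X : ℝ[X]) ^ d l)
      = (∑ l, C (w l) * X ^ d l) - ∑ l, C (β l) * X ^ d l := nodeForm_sub d w β
  have h1 : (∑ l, C ((![w - β, w + β] : Fin 2 → Fin 4 → ℝ) 1 l) * (X : ℝ[X]) ^ d l)
      = (∑ l, C (w l) * X ^ d l) + ∑ l, C (β l) * X ^ d l := nodeForm_add d w β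
  rw [det_pencil_hollowCorner, hn, h0, h1, map_one, map_neg, map_one]
  ring

/-- **Class R0 (`ε = (−1,−1)`, two conjugate pairs `N(u) ± i·N(α)`, `N(w) ± i·N(β)`)**:
`−det = R(P² + Q²) + P(R² + S²)` with `(P, Q, R, S) = (N u, N α, N w, N β)` (`e₃` of the four complex nodes is twice this). [folklore] -/
theorem neg_det_pencil_R0 (d : Fin 4 → ℕ) (u w α β : Fin 4 → ℝ) :
    -(∑ l, ((X : ℝ[X]) ^ d l) • (!![(-1) * u l + (-1) * w l, α l, β l; α l, u l, 0; β l, 0, w l] : Matrix (Fin 3) (Fin 3) ℝ).map C).det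
      = (∑ l, C (w l) * X ^ d l) * ((∑ l, C (u l) * X ^ d l) ^ 2 + (∑ l, C (α l) * X ^ d l) ^ 2)
          + (∑ l, C (u l) * X ^ d l) * ((∑ l, C (w l) * X ^ d l) ^ 2 + (∑ l, C (β l) * X ^ d l) ^ 2) := by
  rw [det_pencil_hollowCorner]
  simp only [map_one, map_neg]
  ring

/-- Multiplying by a non-zero constant does not change the positive-root count. [folklore] -/
theorem card_posRoots_C_mul (c : ℝ) (hc : c ≠ 0) (p q : ℝ[X]) (h : C c * p = q) :
    (q.roots.toFinset.filter (fun t => 0 < t)).card = (p.roots.toFinset.filter (fun t => 0 < t)).card := by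
  rw [← h, Polynomial.roots_C_mul _ hc]

/-! ## 23. `DoorA34` ⟺ the three node-row families — support by support -/

/-- **THE ROW `ζ(3,4; d) ≤ 18` IN NODE FORM (support level).**  For every exponent vector `d`, `PosRootLawOn 3 4 18 d` (every real
symmetric `3 × 3` four-letter pencil on `d` has `≤ 18` distinct positive det-roots) holds IF AND ONLY IF, writing `N(c) = ∑_l C(c_l)X^{d_l}`:
(R4) for all `ℓ₀, ℓ₁, ℓ₂, ℓ₃ : Fin 4 → ℝ` — four ARBITRARY real `4`-nomials `N(ℓⱼ)` on `d` — the `20`-nomial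
  `e₃ = ∑ᵢ ∏_{j ≠ i} N(ℓⱼ) = N(ℓ₀)N(ℓ₁)N(ℓ₂) + N(ℓ₀)N(ℓ₁)N(ℓ₃) + N(ℓ₀)N(ℓ₂)N(ℓ₃) + N(ℓ₁)N(ℓ₂)N(ℓ₃)` has `≤ 18` distinct positive roots;
(R2) for all `p, q, ℓ₀, ℓ₁`: `(N(p)² + N(q)²)(N(ℓ₀) + N(ℓ₁)) + 2·N(p)N(ℓ₀)N(ℓ₁)` has `≤ 18` distinct positive roots;
(R0) for all `p, q, r, s`: `N(r)(N(p)² + N(q)²) + N(p)(N(r)² + N(s)²)` has `≤ 18` distinct positive roots.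
(`e₃` of the four nodes with `0 / 1 / 2` complex-conjugate pairs, up to the factors `1 / 1 / 2`.)  The Descartes ceiling of each family is `19`
(supports `d_i + d_j + d_k`); none of the three is bounded here. [folklore] -/
theorem posRootLawOn_iff_nodeRows (d : Fin 4 → ℕ) :
    PosRootLawOn 3 4 18 d ↔
      (∀ ℓ : Fin 4 → Fin 4 → ℝ,
        ((∑ i, ∏ j ∈ Finset.univ.erase i, ∑ l, C (ℓ j l) * (X : ℝ[X]) ^ d l).roots.toFinset.filter (fun t => 0 < t)).card ≤ 18) ∧
      (∀ (p q : Fin 4 → ℝ) (ℓ : Fin 2 → Fin 4 → ℝ),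
        ((((∑ l, C (p l) * (X : ℝ[X]) ^ d l) ^ 2 + (∑ l, C (q l) * X ^ d l) ^ 2)
              * ((∑ l, C (ℓ 0 l) * X ^ d l) + (∑ l, C (ℓ 1 l) * X ^ d l))
            + 2 * (∑ l, C (p l) * X ^ d l) * (∑ l, C (ℓ 0 l) * X ^ d l) * (∑ l, C (ℓ 1 l) * X ^ d l)).roots.toFinset.filter
          (fun t => 0 < t)).card ≤ 18) ∧
      (∀ (p q r s : Fin 4 → ℝ),
        (((∑ l, C (r l) * (X : ℝ[X]) ^ d l) * ((∑ l, C (p l) * X ^ d l) ^ 2 + (∑ l, C (q l) * X ^ d l) ^ 2)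
            + (∑ l, C (p l) * X ^ d l) * ((∑ l, C (r l) * X ^ d l) ^ 2 + (∑ l, C (s l) * X ^ d l) ^ 2)).roots.toFinset.filter
          (fun t => 0 < t)).card ≤ 18) := by
  have h2C : ∀ P Q : ℝ[X], 2 * P = Q → C (2 : ℝ) * P = Q := fun P Q h => by rw [map_ofNat]; exact h
  have hm2C : ∀ P Q : ℝ[X], -2 * P = Q → C (-2 : ℝ) * P = Q := fun P Q h => by rw [map_neg, map_ofNat]; exact h
  have hm1C : ∀ P Q : ℝ[X], -P = Q → C (-1 : ℝ) * P = Q := fun P Q h => by rw [map_neg, map_one, neg_one_mul]; exact h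
  constructor
  · intro h
    have hHC := (posRootLawOn_iff_signedHollowCornerRows d).mp h
    refine ⟨fun ℓ => ?_, fun p q ℓ => ?_, fun p q r s => ?_⟩
    · -- R4: `u = (ℓ₀+ℓ₁)/2, α = (ℓ₁−ℓ₀)/2, w = (ℓ₂+ℓ₃)/2, β = (ℓ₃−ℓ₂)/2`
      have hid := two_mul_det_pencil_R4 d (fun l => (ℓ 0 l + ℓ 1 l) / 2) (fun l => (ℓ 2 l + ℓ 3 l) / 2)
        (fun l => (ℓ 1 l - ℓ 0 l) / 2) (fun l => (ℓ 3 l - ℓ 2 l) / 2)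
      have hvec : (![(fun l => (ℓ 0 l + ℓ 1 l) / 2) - (fun l => (ℓ 1 l - ℓ 0 l) / 2),
          (fun l => (ℓ 0 l + ℓ 1 l) / 2) + (fun l => (ℓ 1 l - ℓ 0 l) / 2),
          (fun l => (ℓ 2 l + ℓ 3 l) / 2) - (fun l => (ℓ 3 l - ℓ 2 l) / 2),
          (fun l => (ℓ 2 l + ℓ 3 l) / 2) + (fun l => (ℓ 3 l - ℓ 2 l) / 2)] : Fin 4 → Fin 4 → ℝ) = ℓ := by
        funext j l
        fin_cases j <;> simp <;> ring
      rw [hvec] at hid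
      rw [card_posRoots_C_mul 2 two_ne_zero _ _ (h2C _ _ hid)]
      exact hHC 1 1 _ _ _ _ (Or.inl rfl) (Or.inl rfl)
    · -- R2: `w = −p, β = q, u = (ℓ₀+ℓ₁)/2, α = (ℓ₁−ℓ₀)/2`, sign class `(1,−1)`
      have hid := neg_two_mul_det_pencil_R2 d (fun l => (ℓ 0 l + ℓ 1 l) / 2) (-p) (fun l => (ℓ 1 l - ℓ 0 l) / 2) q
      have hvec : (![(fun l => (ℓ 0 l + ℓ 1 l) / 2) - (fun l => (ℓ 1 l - ℓ 0 l) / 2),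
          (fun l => (ℓ 0 l + ℓ 1 l) / 2) + (fun l => (ℓ 1 l - ℓ 0 l) / 2)] : Fin 2 → Fin 4 → ℝ) = ℓ := by
        funext j l
        fin_cases j <;> simp <;> ring
      rw [hvec, neg_neg] at hid
      rw [card_posRoots_C_mul (-2) (by norm_num) _ _ (hm2C _ _ hid)]
      exact hHC 1 (-1) _ _ _ _ (Or.inl rfl) (Or.inr rfl)
    · -- R0: `(u, α, w, β) = (p, q, r, s)`, sign class `(−1,−1)`
      have hid := neg_det_pencil_R0 d p r q s
      rw [card_posRoots_C_mul (-1) (by norm_num) _ _ (hm1C _ _ hid)]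
      exact hHC (-1) (-1) _ _ _ _ (Or.inr rfl) (Or.inr rfl)
  · rintro ⟨h4, h2, h0⟩
    refine (posRootLawOn_iff_signedHollowCornerRows d).mpr fun ε₁ ε₂ u w α β hε₁ hε₂ => ?_
    rcases hε₁ with rfl | rfl <;> rcases hε₂ with rfl | rfl
    · -- (1,1) = R4
      rw [← card_posRoots_C_mul 2 two_ne_zero _ _ (h2C _ _ (two_mul_det_pencil_R4 d u w α β))]
      exact h4 _
    · -- (1,−1) = R2
      rw [← card_posRoots_C_mul (-2) (by norm_num) _ _ (hm2C _ _ (neg_two_mul_det_pencil_R2 d u w α β))]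
      exact h2 (-w) β ![u - α, u + α]
    · -- (−1,1) = R2, mirrored
      rw [← card_posRoots_C_mul (-2) (by norm_num) _ _ (hm2C _ _ (neg_two_mul_det_pencil_R2' d u w α β))]
      exact h2 (-u) α ![w - β, w + β]
    · -- (−1,−1) = R0
      rw [← card_posRoots_C_mul (-1) (by norm_num) _ _ (hm1C _ _ (neg_det_pencil_R0 d u w α β))]
      exact h0 u α w β

/-- **`DoorA34` IN NODE FORM — THE DOOR IS THREE EXPLICIT FEWNOMIAL ROW FAMILIES.**  The cell's typed target `DoorA34 = PosRootLawAt 3 4 18`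
(`Iff.rfl`-equal to the route item `Theses.LacunarySymmetroid.DoorA34`, stmt-ValiantsHypothesis-19980) holds IF AND ONLY IF on every support
`d : Fin 4 → ℕ`, with `N(c) = ∑_l C(c_l)X^{d_l}`:
(R4) `e₃` of ANY FOUR REAL `4`-NOMIALS on `d` — `∑ᵢ ∏_{j≠i} N(ℓⱼ)` — has `≤ 18` distinct positive roots;
(R2) `(N(p)² + N(q)²)(N(ℓ₀) + N(ℓ₁)) + 2·N(p)N(ℓ₀)N(ℓ₁)` has `≤ 18` distinct positive roots;
(R0) `N(r)(N(p)² + N(q)²) + N(p)(N(r)² + N(s)²)` has `≤ 18` distinct positive roots.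
Cayley's `e₃(y) = y₁y₂y₃ + y₁y₂y₄ + y₁y₃y₄ + y₂y₃y₄` on the node forms, with `0 / 1 / 2` complex-conjugate pairs of nodes (classes R4 / R2 / R0).
Each family has Descartes ceiling `19`; NONE is bounded here — `DoorA34` stays OPEN; `ζ_sym(3,4) ∈ {18, 19}`. [folklore] -/
theorem doorA34_iff_nodeRows :
    DoorA34 ↔
      (∀ (d : Fin 4 → ℕ) (ℓ : Fin 4 → Fin 4 → ℝ),
        ((∑ i, ∏ j ∈ Finset.univ.erase i, ∑ l, C (ℓ j l) * (X : ℝ[X]) ^ d l).roots.toFinset.filter (fun t => 0 < t)).card ≤ 18) ∧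
      (∀ (d : Fin 4 → ℕ) (p q : Fin 4 → ℝ) (ℓ : Fin 2 → Fin 4 → ℝ),
        ((((∑ l, C (p l) * (X : ℝ[X]) ^ d l) ^ 2 + (∑ l, C (q l) * X ^ d l) ^ 2)
              * ((∑ l, C (ℓ 0 l) * X ^ d l) + (∑ l, C (ℓ 1 l) * X ^ d l))
            + 2 * (∑ l, C (p l) * X ^ d l) * (∑ l, C (ℓ 0 l) * X ^ d l) * (∑ l, C (ℓ 1 l) * X ^ d l)).roots.toFinset.filter
          (fun t => 0 < t)).card ≤ 18) ∧
      (∀ (d : Fin 4 → ℕ) (p q r s : Fin 4 → ℝ),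
        (((∑ l, C (r l) * (X : ℝ[X]) ^ d l) * ((∑ l, C (p l) * X ^ d l) ^ 2 + (∑ l, C (q l) * X ^ d l) ^ 2)
            + (∑ l, C (p l) * X ^ d l) * ((∑ l, C (r l) * X ^ d l) ^ 2 + (∑ l, C (s l) * X ^ d l) ^ 2)).roots.toFinset.filter
          (fun t => 0 < t)).card ≤ 18) := by
  constructor
  · intro h
    exact ⟨fun d => ((posRootLawOn_iff_nodeRows d).mp (h d)).1, fun d => ((posRootLawOn_iff_nodeRows d).mp (h d)).2.1,
      fun d => ((posRootLawOn_iff_nodeRows d).mp (h d)).2.2⟩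
  · rintro ⟨h4, h2, h0⟩ d
    exact (posRootLawOn_iff_nodeRows d).mpr ⟨h4 d, h2 d, h0 d⟩

/-- **Refutation currency in node form**: `DoorA34` fails iff one of the three node families carries a NINETEEN on some support — e.g. four
real `4`-nomials `ℓ₀,…,ℓ₃` on a common support with `Z₊(ℓ₀ℓ₁ℓ₂ + ℓ₀ℓ₁ℓ₃ + ℓ₀ℓ₂ℓ₃ + ℓ₁ℓ₂ℓ₃) = 19`. [folklore] -/
theorem not_doorA34_iff_nodeNineteen :
    ¬ DoorA34 ↔
      (∃ (d : Fin 4 → ℕ) (ℓ : Fin 4 → Fin 4 → ℝ),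
        19 ≤ ((∑ i, ∏ j ∈ Finset.univ.erase i, ∑ l, C (ℓ j l) * (X : ℝ[X]) ^ d l).roots.toFinset.filter (fun t => 0 < t)).card) ∨
      (∃ (d : Fin 4 → ℕ) (p q : Fin 4 → ℝ) (ℓ : Fin 2 → Fin 4 → ℝ),
        19 ≤ ((((∑ l, C (p l) * (X : ℝ[X]) ^ d l) ^ 2 + (∑ l, C (q l) * X ^ d l) ^ 2)
              * ((∑ l, C (ℓ 0 l) * X ^ d l) + (∑ l, C (ℓ 1 l) * X ^ d l))
            + 2 * (∑ l, C (p l) * X ^ d l) * (∑ l, C (ℓ 0 l) * X ^ d l) * (∑ l, C (ℓ 1 l) * X ^ d l)).roots.toFinset.filter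
          (fun t => 0 < t)).card) ∨
      (∃ (d : Fin 4 → ℕ) (p q r s : Fin 4 → ℝ),
        19 ≤ (((∑ l, C (r l) * (X : ℝ[X]) ^ d l) * ((∑ l, C (p l) * X ^ d l) ^ 2 + (∑ l, C (q l) * X ^ d l) ^ 2)
            + (∑ l, C (p l) * X ^ d l) * ((∑ l, C (r l) * X ^ d l) ^ 2 + (∑ l, C (s l) * X ^ d l) ^ 2)).roots.toFinset.filter
          (fun t => 0 < t)).card) := by
  rw [doorA34_iff_nodeRows, not_and_or, not_and_or]
  push Not
  simp only [Nat.lt_iff_add_one_le, Nat.reduceAdd]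

end Summit.ValiantsHypothesis.ValiantsHypothesis.Theorems.LacunarySymmetroidMatrixDescartes.Census.EqualDiagonal
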